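import Literature.Topology.FourManifolds.NonSeparatingSpheresCoverArc
import Literature.Topology.FourManifolds.NonSeparatingSpheresSideFunction
import Literature.Topology.FourManifolds.NonSeparatingSpheresLoopLift
import HarnessLib

/-!
# Budney–Gabai Thm. 3.13: the dual circle of a non-separating sphere has degree `±1` over `S¹`

Fact seat of `Literature.Topology.FourManifolds.BudneyGabai2019_thm_3_13` (R. Budney, D. Gabai,
*Knotted 3-balls in `S⁴`*, arXiv:1912.09029, Thm. 3.13: `Diff(S¹ × Sⁿ)` acts transitively on the
non-separating `n`-spheres of `S¹ × Sⁿ`).  The printed proof (p. 22): *"complementary to a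
non-separating sphere there is an embedding `S¹ → S¹ × Sⁿ` that intersects the sphere precisely
once and transversely.  Since `dim(S¹ × Sⁿ) ≥ 4`, we can isotope our embedding to be equal to
`S¹ × {*}`"*.  The isotopy is Whitney's theorem for *homotopic* embedded circles; that the dual
circle `c` is homotopic to `S¹ × {*}` (suitably oriented) is the statement that its **degree over
`S¹` is `±1`**, which is what "intersects the sphere precisely once and transversely" together
with "non-separating" yields.  This file proves it
(`BudneyGabai2019_thm_3_13.exists_dualCircle_degree`): for a smoothly embedded `n`-sphere
`e : Sⁿ → S¹ × Sⁿ`, `n ≥ 2`, with connected complement there is a smoothly embedded circle `c`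
meeting `e(Sⁿ)` in exactly one point whose lift `c̃` to the cyclic cover `ℝ × Sⁿ` satisfies
`c̃(θ + 2π) = τ_d c̃(θ)` with `d = ±1`.

## Proof (crossing count in the cyclic cover)

Let `ẽ` be a lift of `e`, `G` a defining function of `ẽ(Sⁿ)` (`NonSeparatingSpheresSideFunction`:
`G = 0` exactly on `ẽ(Sⁿ)`, `ker dG = T ẽ(Sⁿ)`, signs `σ±` towards the ends), `γ̃` a normal arc
to `ẽ(Sⁿ)` at `ẽ x₀` in one sheet (`NonSeparatingSpheresCoverArc`), `c` the circle closing its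
projection `γ` through the complement of `e(Sⁿ)` (`exists_circle_through_arc`), `c̃` a lift of
`c` with degree `d` (`NonSeparatingSpheresLoopLift`).  Over one period `[θ₀, θ₀ + 2π]` the loop
`c̃` meets `⋃ₘ τₘ ẽ(Sⁿ)` exactly once, at `θ₁`, in the translate `τ_{m₁} ẽ(Sⁿ)`.  Put
`s(m) :⇔ σ₊ G(τ₋ₘ c̃ θ₀) < 0`.  Since `c̃(θ₀ + 2π) = τ_d c̃(θ₀)`, the sign of `σ₊ G ∘ τ₋ₘ ∘ c̃` at
`θ₀ + 2π` is `s(m - d)`.  For `m ≠ m₁` that function has no zero on the period, so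
`s(m) ↔ s(m - d)` (intermediate values); for `m = m₁` it has the single zero `θ₁`, where it
changes sign — near `θ₁`, `c̃` is the lift `τ_{m₁} γ̃ ∘ γ⁻¹ ∘ c` of the normal arc, and
`(G ∘ γ̃)'(0) = dG(γ̃'(0)) ≠ 0` by transversality — so `¬ (s(m₁) ↔ s(m₁ - d))`.  Such a one-jump
predicate cannot be eventually false in both directions (`OneJump.false_of_bounded`), which rules
out equal signs `σ₊ σ₋ > 0` at the two ends (then `{σ₊ G ≤ 0}` is bounded); with opposite signs
`s` is false towards one end and true towards the other, and a one-jump predicate with opposite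
tails has `d = ±1` (`OneJump.eq_one_or_eq_neg_one_of_tails`).

Everything here is proved; no definition and no named fact is introduced.

## References

* R. Budney, D. Gabai, *Knotted 3-balls in `S⁴`*, arXiv:1912.09029 (v2), §3, proof of Thm. 3.13
  (p. 22). [BudneyGabai2019]
* A. Hatcher, *Algebraic Topology*, CUP (2002), §1.1 (degree via lifts). [HatcherAT2002]
-/

noncomputable section

open scoped Manifold ContDiff Topology Real
open Set Function Metric Module Filter

namespace Literature.Topology.FourManifolds

/-! ### One-jump predicates on `ℤ` -/

namespace OneJump

/-- Ascending chain of equivalences. [folklore] -/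
theorem iff_of_chain {u : ℤ → Prop} (a : ℤ) (n : ℕ)
    (h : ∀ i : ℕ, i < n → (u (a + i + 1) ↔ u (a + i))) : u (a + n) ↔ u a := by
  induction n with
  | zero => simp
  | succ n ih =>
    rw [show a + ((n + 1 : ℕ) : ℤ) = a + n + 1 by push_cast; ring, h n (Nat.lt_succ_self n)]
    exact ih fun i hi ↦ h i (Nat.lt_succ_of_lt hi)

/-- Descending chain of equivalences. [folklore] -/
theorem iff_of_chain_desc {u : ℤ → Prop} (a : ℤ) (n : ℕ)
    (h : ∀ i : ℕ, i < n → (u (a - i) ↔ u (a - i - 1))) : u a ↔ u (a - n) := by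
  induction n with
  | zero => simp
  | succ n ih =>
    rw [ih fun i hi ↦ h i (Nat.lt_succ_of_lt hi),
      show a - ((n + 1 : ℕ) : ℤ) = a - n - 1 by push_cast; ring]
    exact h n (Nat.lt_succ_self n)

/-- Step along a progression `k ↦ x + k d`: from `s m ↔ s (m - d)` off `m₀`, if `x + k d ≠ m₀`
then `s (x + k d) ↔ s (x + (k - 1) d)`. [folklore] -/
theorem step {s : ℤ → Prop} {d m₀ : ℤ} (h : ∀ m, m ≠ m₀ → (s m ↔ s (m - d))) (x k : ℤ)
    (hk : x + k * d ≠ m₀) : s (x + k * d) ↔ s (x + (k - 1) * d) := by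
  rw [h _ hk, show x + k * d - d = x + (k - 1) * d by ring]

/-- **No bounded one-jump predicate.**  If `s m ↔ s (m - d)` for all `m ≠ m₀` but not for
`m = m₀`, then `s` cannot be false outside a bounded set. [folklore] -/
theorem false_of_bounded {s : ℤ → Prop} {d m₀ : ℤ}
    (h : ∀ m, m ≠ m₀ → (s m ↔ s (m - d))) (h₀ : ¬ (s m₀ ↔ s (m₀ - d)))
    {M : ℤ} (hM : ∀ m, M ≤ |m| → ¬ s m) : False := by
  have hd : d ≠ 0 := by
    rintro rfl
    exact h₀ (by simp)
  set u : ℤ → Prop := fun k ↦ s (m₀ + k * d) with hu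
  have hstep : ∀ k : ℤ, k ≠ 0 → (u k ↔ u (k - 1)) := fun k hk ↦ by
    refine step h m₀ k fun hk' ↦ hk ?_
    have : k * d = 0 := by linarith
    exact (mul_eq_zero.1 this).resolve_right hd
  obtain ⟨N, hN1, hN2⟩ : ∃ N : ℕ, M ≤ |m₀ + N * d| ∧ M ≤ |m₀ + (-1 - N) * d| := by
    refine ⟨(|M| + |m₀|).toNat, ?_, ?_⟩
    · have hN : (|M| + |m₀| : ℤ) ≤ ((|M| + |m₀|).toNat : ℕ) := Int.self_le_toNat _
      rcases hd.lt_or_gt with hd' | hd'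
      · rw [le_abs]
        right
        nlinarith [abs_nonneg M, abs_nonneg m₀, le_abs_self M, neg_abs_le m₀, le_abs_self m₀,
          neg_abs_le M]
      · rw [le_abs]
        left
        nlinarith [abs_nonneg M, abs_nonneg m₀, le_abs_self M, neg_abs_le m₀, le_abs_self m₀,
          neg_abs_le M]
    · have hN : (|M| + |m₀| : ℤ) ≤ ((|M| + |m₀|).toNat : ℕ) := Int.self_le_toNat _
      rcases hd.lt_or_gt with hd' | hd'
      · rw [le_abs]
        left
        nlinarith [abs_nonneg M, abs_nonneg m₀, le_abs_self M, neg_abs_le m₀, le_abs_self m₀,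
          neg_abs_le M]
      · rw [le_abs]
        right
        nlinarith [abs_nonneg M, abs_nonneg m₀, le_abs_self M, neg_abs_le m₀, le_abs_self m₀,
          neg_abs_le M]
  have h1 : u N ↔ u 0 := by
    have := iff_of_chain (u := u) 0 N fun i _ ↦ by
      have := hstep (0 + i + 1) (by omega)
      rwa [show (0 : ℤ) + i + 1 - 1 = 0 + i by ring] at this
    simpa using this
  have h2 : u (-1) ↔ u (-1 - N) :=
    iff_of_chain_desc (u := u) (-1) N fun i _ ↦ hstep (-1 - i) (by omega)
  have hf1 : ¬ u N := hM _ hN1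
  have hf2 : ¬ u (-1 - N) := by
    have := hM _ hN2
    simpa [hu] using this
  have e1 : s (m₀ - d) ↔ u (-1) := by
    simp only [hu]
    rw [show m₀ + (-1 : ℤ) * d = m₀ - d by ring]
  have e0 : s m₀ ↔ u 0 := by simp [hu]
  have hu0 : ¬ u 0 := fun h0 ↦ hf1 (h1.2 h0)
  have hu1 : ¬ u (-1) := fun h1' ↦ hf2 (h2.1 h1')
  exact h₀ (by rw [e0, e1]; exact iff_of_false hu0 hu1)

/-- **A one-jump predicate with opposite tails has step `±1`**: if `s m ↔ s (m - d)` for all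
`m ≠ m₀` but not for `m = m₀`, and `s` holds far to the left and fails far to the right, then
`d = ±1`. [folklore] -/
theorem eq_one_or_eq_neg_one_of_tails {s : ℤ → Prop} {d m₀ : ℤ}
    (h : ∀ m, m ≠ m₀ → (s m ↔ s (m - d))) (h₀ : ¬ (s m₀ ↔ s (m₀ - d)))
    {M : ℤ} (hlo : ∀ m, m ≤ -M → s m) (hhi : ∀ m, M ≤ m → ¬ s m) : d = 1 ∨ d = -1 := by
  have hd : d ≠ 0 := by
    rintro rfl
    exact h₀ (by simp)
  by_contra hd1
  set x := m₀ + 1 with hx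
  have havoid : ∀ k : ℤ, x + k * d ≠ m₀ := by
    intro k hk
    have hkd : d * k = -1 := by linarith
    exact hd1 (Int.eq_one_or_neg_one_of_mul_eq_neg_one hkd)
  set v : ℤ → Prop := fun k ↦ s (x + k * d) with hv
  have hstep : ∀ k, v k ↔ v (k - 1) := fun k ↦ step h x k (havoid k)
  set N : ℕ := (|M| + |x|).toNat with hNdef
  have hN : (|M| + |x| : ℤ) ≤ (N : ℤ) := Int.self_le_toNat _
  have h1 : v N ↔ v 0 := by
    have := iff_of_chain (u := v) 0 N fun i _ ↦ by
      have := hstep (0 + i + 1)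
      rwa [show (0 : ℤ) + i + 1 - 1 = 0 + i by ring] at this
    simpa using this
  have h2 : v 0 ↔ v (0 - N) := iff_of_chain_desc (u := v) 0 N fun i _ ↦ hstep (0 - i)
  have hM1 := le_abs_self M
  have hM2 := neg_abs_le M
  have hx1 := le_abs_self x
  have hx2 := neg_abs_le x
  rcases hd.lt_or_gt with hneg | hpos
  · have ht : v N := hlo _ (by nlinarith)
    have hf : ¬ v (0 - N) := hhi _ (by nlinarith)
    exact hf (h2.1 (h1.1 ht))
  · have hf : ¬ v N := hhi _ (by nlinarith)
    have ht : v (0 - N) := hlo _ (by nlinarith)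
    exact hf (h1.2 (h2.2 ht))

/-- **A one-jump predicate with opposite tails has step `±1`** (mirror image: false far to the
left, true far to the right), by reflecting `m ↦ -m`. [folklore] -/
theorem eq_one_or_eq_neg_one_of_tails' {s : ℤ → Prop} {d m₀ : ℤ}
    (h : ∀ m, m ≠ m₀ → (s m ↔ s (m - d))) (h₀ : ¬ (s m₀ ↔ s (m₀ - d)))
    {M : ℤ} (hlo : ∀ m, m ≤ -M → ¬ s m) (hhi : ∀ m, M ≤ m → s m) : d = 1 ∨ d = -1 := by
  -- `u m = s (-m)` is a one-jump predicate with jump at `d - m₀`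
  set u : ℤ → Prop := fun m ↦ s (-m) with hu
  have hu1 : ∀ m, m ≠ d - m₀ → (u m ↔ u (m - d)) := by
    intro m hm
    simp only [hu]
    have := h (-m + d) (by intro h'; apply hm; linarith)
    rw [show -m + d - d = -m by ring] at this
    rw [show -(m - d) = -m + d by ring]
    exact this.symm
  have hu0 : ¬ (u (d - m₀) ↔ u (d - m₀ - d)) := by
    simp only [hu]
    rw [show -(d - m₀ - d) = m₀ by ring, show -(d - m₀) = m₀ - d by ring]
    exact fun h' ↦ h₀ h'.symm
  exact eq_one_or_eq_neg_one_of_tails hu1 hu0 (M := M)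
    (fun m hm ↦ hhi (-m) (by linarith)) (fun m hm ↦ hlo (-m) (by linarith))

end OneJump

/-- A continuous real function without zeros on `[a, b]` has the same sign at `a` and at `b`
(intermediate value theorem). [folklore] -/
theorem neg_iff_neg_of_forall_ne_zero {f : ℝ → ℝ} {a b : ℝ} (hab : a ≤ b)
    (hfc : ContinuousOn f (Icc a b)) (hnz : ∀ θ ∈ Icc a b, f θ ≠ 0) : (f a < 0 ↔ f b < 0) := by
  constructor
  · intro h1
    by_contra h2
    push Not at h2
    obtain ⟨θ, hθ, hθ0⟩ := intermediate_value_Icc hab hfc ⟨h1.le, h2⟩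
    exact hnz θ hθ hθ0
  · intro h1
    by_contra h2
    push Not at h2
    obtain ⟨θ, hθ, hθ0⟩ := intermediate_value_Icc' hab hfc ⟨h1.le, h2⟩
    exact hnz θ hθ hθ0

/-- A continuous real function on `[a, b]` whose only possible zero is an interior point `θ₁` and
which takes both signs on `[a, b]` has opposite signs at `a` and at `b`. [folklore] -/
theorem not_neg_iff_neg_of_sign_change {f : ℝ → ℝ} {a b θ₁ θp θm : ℝ} (hab : a ≤ b)
    (hfc : ContinuousOn f (Icc a b)) (hz : ∀ θ ∈ Icc a b, f θ = 0 → θ = θ₁)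
    (ha : a ≠ θ₁) (hb : b ≠ θ₁) (hθp : θp ∈ Icc a b) (hθm : θm ∈ Icc a b)
    (hpos : 0 < f θp) (hneg : f θm < 0) : ¬ (f a < 0 ↔ f b < 0) := by
  intro hiff
  have ha0 : f a ≠ 0 := fun h ↦ ha (hz a (left_mem_Icc.2 hab) h)
  have hb0 : f b ≠ 0 := fun h ↦ hb (hz b (right_mem_Icc.2 hab) h)
  rcases lt_or_gt_of_ne ha0 with ha' | ha'
  · have hb' : f b < 0 := hiff.1 ha'
    obtain ⟨θ, hθ, hθ0⟩ := intermediate_value_Icc hθp.1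
      (hfc.mono (Icc_subset_Icc_right hθp.2)) ⟨ha'.le, hpos.le⟩
    obtain ⟨θ', hθ', hθ'0⟩ := intermediate_value_Icc' hθp.2
      (hfc.mono (Icc_subset_Icc_left hθp.1)) ⟨hb'.le, hpos.le⟩
    have h1 := hz θ ⟨hθ.1, hθ.2.trans hθp.2⟩ hθ0
    have h2 := hz θ' ⟨hθp.1.trans hθ'.1, hθ'.2⟩ hθ'0
    have hθp1 : θp = θ₁ := le_antisymm (hθ'.1.trans_eq h2) (h1.symm.trans_le hθ.2)
    have : f θp = 0 := by rw [hθp1, ← h1]; exact hθ0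
    linarith
  · have hb' : 0 < f b := lt_of_le_of_ne (not_lt.1 fun h ↦ (lt_asymm ha') (hiff.2 h)) hb0.symm
    obtain ⟨θ, hθ, hθ0⟩ := intermediate_value_Icc' hθm.1
      (hfc.mono (Icc_subset_Icc_right hθm.2)) ⟨hneg.le, ha'.le⟩
    obtain ⟨θ', hθ', hθ'0⟩ := intermediate_value_Icc hθm.2
      (hfc.mono (Icc_subset_Icc_left hθm.1)) ⟨hneg.le, hb'.le⟩
    have h1 := hz θ ⟨hθ.1, hθ.2.trans hθm.2⟩ hθ0
    have h2 := hz θ' ⟨hθm.1.trans hθ'.1, hθ'.2⟩ hθ'0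
    have hθm1 : θm = θ₁ := le_antisymm (hθ'.1.trans_eq h2) (h1.symm.trans_le hθ.2)
    have : f θm = 0 := by rw [hθm1, ← h1]; exact hθ0
    linarith

/-- Tail arithmetic: for `m ≤ -⌈(T - A) / 2π⌉`, `T ≤ A - 2πm`. [folklore] -/
theorem le_add_neg_mul_two_pi {A T : ℝ} {m : ℤ} (hm : m ≤ -⌈(T - A) / (2 * π)⌉) :
    T ≤ A + ((-m : ℤ) : ℝ) * (2 * π) := by
  have hπ2 : (0 : ℝ) < 2 * π := by positivity
  have h1 : ⌈(T - A) / (2 * π)⌉ ≤ -m := by omega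
  have h2 : (T - A) / (2 * π) ≤ ((-m : ℤ) : ℝ) := (Int.le_ceil _).trans (by exact_mod_cast h1)
  rw [div_le_iff₀ hπ2] at h2
  linarith

/-- Tail arithmetic: for `⌈(A - T) / 2π⌉ ≤ m`, `A - 2πm ≤ T`. [folklore] -/
theorem add_neg_mul_two_pi_le {A T : ℝ} {m : ℤ} (hm : ⌈(A - T) / (2 * π)⌉ ≤ m) :
    A + ((-m : ℤ) : ℝ) * (2 * π) ≤ T := by
  have hπ2 : (0 : ℝ) < 2 * π := by positivity
  have h2 : (A - T) / (2 * π) ≤ (m : ℝ) := (Int.le_ceil _).trans (by exact_mod_cast hm)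
  rw [div_le_iff₀ hπ2] at h2
  push_cast
  linarith

/-- Tail arithmetic: for `⌈(T + |A|) / 2π⌉ + 1 ≤ |m|`, `T < |A - 2πm|`. [folklore] -/
theorem lt_abs_add_neg_mul_two_pi {A T : ℝ} {m : ℤ} (hm : ⌈(T + |A|) / (2 * π)⌉ + 1 ≤ |m|) :
    T < |A + ((-m : ℤ) : ℝ) * (2 * π)| := by
  have hπ2 : (0 : ℝ) < 2 * π := by positivity
  have h2 : (T + |A|) / (2 * π) + 1 ≤ |(m : ℝ)| := by
    have : ((⌈(T + |A|) / (2 * π)⌉ + 1 : ℤ) : ℝ) ≤ ((|m| : ℤ) : ℝ) := by exact_mod_cast hm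
    push_cast at this
    have h3 : ((|m| : ℤ) : ℝ) = |(m : ℝ)| := by push_cast; rfl
    linarith [Int.le_ceil ((T + |A|) / (2 * π))]
  have h4 : T + |A| + 2 * π ≤ |(m : ℝ)| * (2 * π) := by
    have := (div_le_iff₀ hπ2).1 (by linarith : (T + |A|) / (2 * π) ≤ |(m : ℝ)| - 1)
    linarith
  have h5 : |(m : ℝ) * (2 * π)| - |A| ≤ |A + ((-m : ℤ) : ℝ) * (2 * π)| := by
    have := abs_sub_abs_le_abs_sub ((m : ℝ) * (2 * π)) A
    rw [show (m : ℝ) * (2 * π) - A = -(A + ((-m : ℤ) : ℝ) * (2 * π)) by push_cast; ring,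
      abs_neg] at this
    exact this
  rw [abs_mul, abs_of_pos hπ2] at h5
  linarith

/-! ### Sign change at a simple zero -/

/-- A real function with a simple zero takes both signs arbitrarily close to it. [folklore] -/
theorem exists_pos_neg_of_hasDerivAt {k : ℝ → ℝ} {k' : ℝ} (hk : HasDerivAt k k' 0) (hk0 : k 0 = 0)
    (hk' : k' ≠ 0) {δ : ℝ} (hδ : 0 < δ) :
    ∃ r₁ r₂ : ℝ, |r₁| < δ ∧ |r₂| < δ ∧ 0 < k r₁ ∧ k r₂ < 0 := by
  have ht : Tendsto (fun t ↦ t⁻¹ • (k (0 + t) - k 0)) (𝓝[≠] 0) (𝓝 k') :=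
    hasDerivAt_iff_tendsto_slope_zero.1 hk
  have ht2 : Tendsto (fun t ↦ k' * (t⁻¹ * k t)) (𝓝[≠] 0) (𝓝 (k' * k')) := by
    have := ht.const_mul k'
    simpa [hk0] using this
  have hpos : 0 < k' * k' := mul_self_pos.2 hk'
  have hev : ∀ᶠ t in 𝓝[≠] (0 : ℝ), 0 < k' * (t⁻¹ * k t) := ht2.eventually_const_lt hpos
  rw [eventually_nhdsWithin_iff, Metric.eventually_nhds_iff] at hev
  obtain ⟨ε, hε, hball⟩ := hev
  set t : ℝ := min δ ε / 2 with htdef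
  have ht0 : 0 < t := by positivity
  have htδ : t < δ := by
    have : min δ ε ≤ δ := min_le_left _ _
    linarith
  have htε : t < ε := by
    have : min δ ε ≤ ε := min_le_right _ _
    linarith
  have h1 : 0 < k' * (t⁻¹ * k t) :=
    hball (by rwa [Real.dist_0_eq_abs, abs_of_pos ht0]) ht0.ne'
  have h2 : 0 < k' * ((-t)⁻¹ * k (-t)) :=
    hball (by rwa [Real.dist_0_eq_abs, abs_neg, abs_of_pos ht0]) (neg_ne_zero.2 ht0.ne')
  have hti : 0 < t⁻¹ := inv_pos.2 ht0
  -- `k t` has the sign of `k'`, `k (-t)` the opposite sign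
  have hkt : 0 < k' * k t := by
    have e : k' * (t⁻¹ * k t) = t⁻¹ * (k' * k t) := by ring
    rw [e] at h1
    by_contra hc
    push Not at hc
    nlinarith
  have hknt : k' * k (-t) < 0 := by
    have e : k' * ((-t)⁻¹ * k (-t)) = -(t⁻¹ * (k' * k (-t))) := by rw [inv_neg]; ring
    rw [e, neg_pos] at h2
    by_contra hc
    push Not at hc
    nlinarith
  have habs1 : |t| < δ := by rwa [abs_of_pos ht0]
  have habs2 : |(-t)| < δ := by rwa [abs_neg, abs_of_pos ht0]
  rcases hk'.lt_or_gt with hneg | hpos'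
  · refine ⟨-t, t, habs2, habs1, ?_, ?_⟩
    · by_contra hc
      push Not at hc
      nlinarith
    · by_contra hc
      push Not at hc
      nlinarith
  · refine ⟨t, -t, habs1, habs2, ?_, ?_⟩
    · by_contra hc
      push Not at hc
      nlinarith
    · by_contra hc
      push Not at hc
      nlinarith

/-! ### Local sections of the covering map and uniqueness of lifts -/

namespace BudneyGabai2019_thm_3_13

variable {n : ℕ}

/-- A real function whose values are integer multiples of `2π`, continuous at a point, is
constant near that point. [folklore] -/
private theorem eventually_eq_of_continuousAt_of_int_mul' {α : Type*} [TopologicalSpace α]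
    {f : α → ℝ} {x₀ : α} (hf : ContinuousAt f x₀) (hZ : ∀ x, ∃ k : ℤ, f x = k * (2 * π)) :
    ∀ᶠ x in 𝓝 x₀, f x = f x₀ := by
  have hπ : (0 : ℝ) < 2 * π := by positivity
  have h := (Metric.tendsto_nhds.1 hf) (2 * π) hπ
  filter_upwards [h] with x hx
  obtain ⟨k, hk⟩ := hZ x
  obtain ⟨k₀, hk₀⟩ := hZ x₀
  rw [hk, hk₀] at hx ⊢
  rw [Real.dist_eq, ← sub_mul, abs_mul, abs_of_pos hπ] at hx
  have h1 : |((k : ℝ) - k₀)| < 1 := by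
    by_contra h2
    push Not at h2
    have : (1 : ℝ) * (2 * π) ≤ |(k : ℝ) - k₀| * (2 * π) := mul_le_mul_of_nonneg_right h2 hπ.le
    linarith
  have h3 : |k - k₀| < 1 := by exact_mod_cast h1
  rw [eq_of_sub_eq_zero (Int.abs_lt_one_iff.1 h3)]

/-- **Local sections of the covering `exp × id : ℝ × Sⁿ → S¹ × Sⁿ`**: through every point `q₁`
there is a (global, set-theoretic) section `σ` of `exp × id` with `σ ((exp × id) q₁) = q₁` which
is continuous at `(exp × id) q₁` (`σ (z, p) = (A z + const, p)` for an angle function `A` of the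
circle smooth at `e^{i t₁}`). [folklore] -/
theorem exists_localSection (q₁ : ℝ × Metric.sphere (0 : EuclideanSpace ℝ (Fin (n + 1))) 1) :
    ∃ σ : Circle × Metric.sphere (0 : EuclideanSpace ℝ (Fin (n + 1))) 1 →
        ℝ × Metric.sphere (0 : EuclideanSpace ℝ (Fin (n + 1))) 1,
      (∀ y, (Prod.map Circle.exp id (σ y) :
          Circle × Metric.sphere (0 : EuclideanSpace ℝ (Fin (n + 1))) 1) = y) ∧
      σ (Prod.map Circle.exp id q₁) = q₁ ∧
      ContinuousAt σ (Prod.map Circle.exp id q₁ :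
        Circle × Metric.sphere (0 : EuclideanSpace ℝ (Fin (n + 1))) 1) := by
  obtain ⟨A, hA, hAexp⟩ := CircleExpLift.exists_angle_contMDiffAt (Circle.exp q₁.1)
  obtain ⟨k, hk⟩ := Circle.exp_eq_exp.1 (hAexp (Circle.exp q₁.1))
  refine ⟨fun y ↦ (A y.1 - k * (2 * π), y.2), fun y ↦ ?_, ?_, ?_⟩
  · refine Prod.ext ?_ rfl
    change Circle.exp (A y.1 - k * (2 * π)) = y.1
    rw [Circle.exp_sub, hAexp, Circle.exp_int_mul_two_pi, div_one]
  · refine Prod.ext ?_ rfl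
    change A (Circle.exp q₁.1) - k * (2 * π) = q₁.1
    linarith
  · have h1 : ContinuousAt (fun y : Circle × Metric.sphere (0 : EuclideanSpace ℝ (Fin (n + 1))) 1 ↦
        A y.1) (Prod.map Circle.exp id q₁) :=
      hA.continuousAt.comp_of_eq continuousAt_fst rfl
    exact (h1.sub continuousAt_const).prodMk continuousAt_snd

/-- **Uniqueness of lifts, locally**: two maps into the cover `ℝ × Sⁿ` with the same projection
to `S¹ × Sⁿ`, both continuous at `x` and equal at `x`, agree near `x` (their first coordinates
differ by a continuous `2πℤ`-valued function vanishing at `x`). [folklore] -/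
theorem eventuallyEq_of_lifts {X : Type*} [TopologicalSpace X] {x : X}
    {f g : X → ℝ × Metric.sphere (0 : EuclideanSpace ℝ (Fin (n + 1))) 1}
    (hf : ContinuousAt f x) (hg : ContinuousAt g x)
    (hP : ∀ y, (Prod.map Circle.exp id (f y) :
        Circle × Metric.sphere (0 : EuclideanSpace ℝ (Fin (n + 1))) 1) = Prod.map Circle.exp id (g y))
    (h0 : f x = g x) : f =ᶠ[𝓝 x] g := by
  have hZ : ∀ y, ∃ m : ℤ, ((f y).1 - (g y).1) = m * (2 * π) := fun y ↦ by
    obtain ⟨m, hm⟩ := (prodMap_circleExp_eq_iff (f y) (g y)).1 (hP y)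
    refine ⟨m, ?_⟩
    rw [hm]
    ring
  have hcont : ContinuousAt (fun y ↦ (f y).1 - (g y).1) x := hf.fst.sub hg.fst
  filter_upwards [eventually_eq_of_continuousAt_of_int_mul' hcont hZ] with y hy
  rw [h0, sub_self, sub_eq_zero] at hy
  have h2 : (f y).2 = (g y).2 := by
    have := congrArg Prod.snd (hP y)
    simpa using this
  exact Prod.ext hy h2

/-! ### The degree of the dual circle -/
set_option maxHeartbeats 400000 in -- buildfix (bf3-g26): 160k/180k FAIL, 200k PASS at accept time; line-neutral budget line
/-- **The dual circle of a non-separating sphere has degree `±1` over `S¹`.**  Let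
`e : Sⁿ → S¹ × Sⁿ`, `n ≥ 2`, be a smooth embedding whose image has connected complement, and
`x₀ ∈ Sⁿ`.  There is a smoothly embedded circle `c : S¹ → S¹ × Sⁿ` meeting `e(Sⁿ)` exactly in
`c s₀ = e x₀` and equal near that point to a normal arc `γ` of `e(Sⁿ)` (`γ 0 = e x₀`,
`γ'(0) ∉ de_{x₀}(T Sⁿ)`), and a continuous lift `c̃ : ℝ → ℝ × Sⁿ` of `c ∘ circlePoint` through the covering
`exp × id` with `c̃ (θ + 2π) = ((c̃ θ)₁ + 2πd, (c̃ θ)₂)` for an integer `d = ±1` (Budney–Gabai 2019,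
proof of Thm. 3.13, p. 22: the dual circle, which "intersects the sphere precisely once and
transversely", is homotopic to `S¹ × {*}`; see the module docstring for the crossing count in the
cyclic cover that proves it). [cite: BudneyGabai2019, proof of Thm. 3.13 (arXiv:1912.09029 v2, p. 22)] -/
theorem exists_dualCircle_degree (hn : 2 ≤ n)
    {e : Metric.sphere (0 : EuclideanSpace ℝ (Fin (n + 1))) 1 →
      Circle × Metric.sphere (0 : EuclideanSpace ℝ (Fin (n + 1))) 1}
    (he : Manifold.IsSmoothEmbedding (𝓡 n) ((𝓡 1).prod (𝓡 n)) ∞ e)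
    (hconn : IsConnected (range e)ᶜ) (x₀ : Metric.sphere (0 : EuclideanSpace ℝ (Fin (n + 1))) 1) :
    ∃ c : Metric.sphere (0 : EuclideanSpace ℝ (Fin 2)) 1 →
        Circle × Metric.sphere (0 : EuclideanSpace ℝ (Fin (n + 1))) 1,
      Manifold.IsSmoothEmbedding (𝓡 1) ((𝓡 1).prod (𝓡 n)) ∞ c ∧
      (∃ s₀, c s₀ = e x₀ ∧ ∀ s, s ≠ s₀ → c s ∉ range e) ∧
      (∃ γ : ℝ → Circle × Metric.sphere (0 : EuclideanSpace ℝ (Fin (n + 1))) 1,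
        ContMDiff 𝓘(ℝ, ℝ) ((𝓡 1).prod (𝓡 n)) ∞ γ ∧ Injective γ ∧
        (∀ s, Injective (mfderiv 𝓘(ℝ, ℝ) ((𝓡 1).prod (𝓡 n)) γ s)) ∧ γ 0 = e x₀ ∧
        (mfderiv 𝓘(ℝ, ℝ) ((𝓡 1).prod (𝓡 n)) γ 0 (1 : ℝ) :
            EuclideanSpace ℝ (Fin 1) × EuclideanSpace ℝ (Fin n)) ∉
          (mfderiv (𝓡 n) ((𝓡 1).prod (𝓡 n)) e x₀).range ∧
        ∃ U ∈ 𝓝 (e x₀), range c ∩ U = γ '' Icc (-1) 1 ∩ U) ∧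
      ∃ (ct : ℝ → ℝ × Metric.sphere (0 : EuclideanSpace ℝ (Fin (n + 1))) 1) (d : ℤ),
        Continuous ct ∧
        (∀ θ, (Prod.map Circle.exp id (ct θ) :
          Circle × Metric.sphere (0 : EuclideanSpace ℝ (Fin (n + 1))) 1) = c (circlePoint θ)) ∧
        (∀ θ, ct (θ + 2 * π) = ((ct θ).1 + d * (2 * π), (ct θ).2)) ∧ (d = 1 ∨ d = -1) := by
  set P := (Prod.map Circle.exp id : ℝ × Metric.sphere (0 : EuclideanSpace ℝ (Fin (n + 1))) 1 →
        Circle × Metric.sphere (0 : EuclideanSpace ℝ (Fin (n + 1))) 1) with hP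
  have hPs : ContMDiff (𝓘(ℝ, ℝ).prod (𝓡 n)) ((𝓡 1).prod (𝓡 n)) ∞ P := contMDiff_prodMap_circleExp
  have heinj : Injective e := he.isEmbedding.injective
  -- deck translations
  set τ : ℤ → ℝ × Metric.sphere (0 : EuclideanSpace ℝ (Fin (n + 1))) 1 →
      ℝ × Metric.sphere (0 : EuclideanSpace ℝ (Fin (n + 1))) 1 :=
    fun m q ↦ ((q.1 + m * (2 * π), q.2) : ℝ × Metric.sphere (0 : EuclideanSpace ℝ (Fin (n + 1))) 1)
    with hτ
  have hτc : ∀ m, Continuous (τ m) := fun m ↦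
    (continuous_fst.add continuous_const).prodMk continuous_snd
  have hPτ : ∀ m q, P (τ m q) = P q := fun m q ↦ prodMap_circleExp_deck m q
  have hττ : ∀ m m' q, τ m (τ m' q) = τ (m + m') q := fun m m' q ↦ by
    simp only [hτ]
    ext
    · push_cast
      ring
    · rfl
  have hτ0 : ∀ q, τ 0 q = q := fun q ↦ by simp [hτ]
  -- ### the normal arc from the cover and its projection
  obtain ⟨el, hel, hlift, γt, hγs, hγ0, hγoff, hγtr, hγmiss, hγPs, hγPinj, hγPimm, hγP0, hγPoff,
      hγPtr⟩ := exists_coverNormalArc hn he x₀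
  have helc : Continuous el := hel.contMDiff.continuous
  have hPel : ∀ x, P (el x) = e x := fun x ↦ congr_fun hlift x
  set γ := P ∘ γt with hγ
  have hγc : Continuous γ := hγPs.continuous
  -- ### closing up the arc to the dual circle
  have hO : IsOpen (range e)ᶜ := (isCompact_range he.contMDiff.continuous).isClosed.isOpen_compl
  have hE' : finrank ℝ (EuclideanSpace ℝ (Fin 1) × EuclideanSpace ℝ (Fin n)) = n + 1 := by
    rw [finrank_prod, finrank_euclideanSpace_fin, finrank_euclideanSpace_fin]
    omega
  obtain ⟨c, hc, s₀, hs₀, hcO, U, hU, hUeq⟩ :=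
    exists_circle_through_arc (m := n + 1) (by omega) hE' hO hconn γ hγPs hγPinj hγPimm hγPoff
  have hcc : Continuous c := hc.contMDiff.continuous
  have hcs₀ : c s₀ = e x₀ := hs₀.trans hγP0
  have hcK : ∀ s, c s ∈ range e → s = s₀ := fun s hs ↦ by
    by_contra h
    exact hcO s h hs
  -- ### the lift of the circle and its degree
  obtain ⟨ct, hctc, d, hct', hdeck⟩ := exists_loopLift ⟨c, hcc⟩
  have hct : ∀ θ, P (ct θ) = c (circlePoint θ) := hct'
  -- ### the defining function of the lifted sphere
  obtain ⟨G, hGs, hG0, hGker, σp, σm, hσp, hσm, ⟨Tp, hTp⟩, ⟨Tm, hTm⟩, hbdd⟩ :=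
    exists_sideFunction (n := n) (by omega) hel
  have hGc : Continuous G := hGs.continuous
  -- ### the crossing parameter `θ₁` and the period `[θ₀, θ₀ + 2π]`
  obtain ⟨θ₁, hθ₁⟩ := circlePoint_surjective s₀
  set θ₀ : ℝ := θ₁ - π with hθ₀
  have hper : ∀ θ ∈ Icc θ₀ (θ₀ + 2 * π), circlePoint θ = s₀ → θ = θ₁ := by
    intro θ hθ hθs
    rw [← hθ₁] at hθs
    obtain ⟨k, hk⟩ := exists_eq_add_of_circlePoint_eq hθs
    have h1 : |(k : ℝ) * (2 * π)| ≤ π := by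
      rw [show (k : ℝ) * (2 * π) = θ - θ₁ by rw [hk]; ring, abs_le]
      constructor <;> linarith [hθ.1, hθ.2]
    have hk0 : k = 0 := by
      by_contra h0
      have h2 : (1 : ℝ) ≤ |(k : ℝ)| := by exact_mod_cast Int.one_le_abs h0
      rw [abs_mul, abs_of_pos (by positivity : (0 : ℝ) < 2 * π)] at h1
      nlinarith [Real.pi_pos]
    rw [hk, hk0]
    simp
  have hθ₁mem : θ₁ ∈ Icc θ₀ (θ₀ + 2 * π) := ⟨by linarith [Real.pi_pos], by linarith [Real.pi_pos]⟩
  -- the translate crossed at `θ₁`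
  obtain ⟨m₁, hm₁⟩ : ∃ m₁ : ℤ, ct θ₁ = τ m₁ (el x₀) := by
    obtain ⟨m₁, hm₁⟩ := (prodMap_circleExp_eq_iff (ct θ₁) (el x₀)).1
      (by show P (ct θ₁) = P (el x₀); rw [hct, hθ₁, hcs₀, hPel])
    exact ⟨m₁, hm₁⟩
  -- ### zeros of `G ∘ τ₋ₘ ∘ c̃` on the period
  have hzero : ∀ θ ∈ Icc θ₀ (θ₀ + 2 * π), ∀ m : ℤ, G (τ (-m) (ct θ)) = 0 → θ = θ₁ ∧ m = m₁ := by
    intro θ hθ m hGm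
    obtain ⟨x, hx⟩ := (hG0 _).1 hGm
    have hctθ : ct θ = τ m (el x) := by
      have := congrArg (τ m) hx
      rw [hττ, add_neg_cancel, hτ0] at this
      exact this.symm
    have hcθ : c (circlePoint θ) = e x := by rw [← hct, hctθ, hPτ, hPel]
    have hθ1 : θ = θ₁ := hper θ hθ (hcK _ ⟨x, hcθ.symm⟩)
    refine ⟨hθ1, ?_⟩
    subst hθ1
    have hxx : x = x₀ := heinj (by rw [← hcθ, hθ₁, hcs₀])
    subst hxx
    rw [hm₁] at hctθ
    have := congrArg Prod.fst hctθ
    simp only [hτ] at this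
    have h2 : ((m₁ : ℝ) - m) * (2 * π) = 0 := by linarith
    rcases mul_eq_zero.1 h2 with h3 | h3
    · exact_mod_cast (sub_eq_zero.1 h3).symm
    · exfalso
      linarith [Real.pi_pos]
  -- ### the signed side function along the translated loop
  set hf : ℤ → ℝ → ℝ := fun m θ ↦ σp * G (τ (-m) (ct θ)) with hhf
  have hfc : ∀ m, Continuous (hf m) := fun m ↦
    continuous_const.mul (hGc.comp ((hτc _).comp hctc))
  have hf_zero : ∀ θ ∈ Icc θ₀ (θ₀ + 2 * π), ∀ m, hf m θ = 0 → θ = θ₁ ∧ m = m₁ := by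
    intro θ hθ m h0
    rcases mul_eq_zero.1 h0 with h1 | h1
    · exact (hσp h1).elim
    · exact hzero θ hθ m h1
  -- value after one turn
  have hf_turn : ∀ m, hf m (θ₀ + 2 * π) = hf (m - d) θ₀ := fun m ↦ by
    simp only [hhf]
    rw [hdeck θ₀]
    have e1 : τ (-m) (((ct θ₀).1 + d * (2 * π), (ct θ₀).2) :
        ℝ × Metric.sphere (0 : EuclideanSpace ℝ (Fin (n + 1))) 1) = τ (-(m - d)) (ct θ₀) := by
      simp only [hτ]
      ext
      · push_cast
        ring
      · rfl
    rw [e1]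
  -- the crossing predicate
  set s : ℤ → Prop := fun m ↦ hf m θ₀ < 0 with hsdef
  -- ### `m ≠ m₁`: no zero on the period, hence the same sign at both ends
  have hle : θ₀ ≤ θ₀ + 2 * π := by linarith [Real.pi_pos]
  have hrel : ∀ m, m ≠ m₁ → (s m ↔ s (m - d)) := by
    intro m hm
    simp only [hsdef]
    rw [← hf_turn]
    exact neg_iff_neg_of_forall_ne_zero hle (hfc m).continuousOn fun θ hθ h0 ↦
      hm (hf_zero θ hθ m h0).2
  -- ### `m = m₁`: sign change at the transversal crossing
  -- local section at the crossing point
  obtain ⟨σ, hσP, hσq, hσc⟩ := exists_localSection (ct θ₁)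
  have hσP' : ∀ y, P (σ y) = y := hσP
  have hPq : (Prod.map Circle.exp id (ct θ₁) :
      Circle × Metric.sphere (0 : EuclideanSpace ℝ (Fin (n + 1))) 1) = e x₀ := by
    show P (ct θ₁) = e x₀
    rw [hct, hθ₁, hcs₀]
  rw [hPq] at hσq hσc
  -- `c̃ = σ ∘ c ∘ circlePoint` near `θ₁`
  have hlift1 : ct =ᶠ[𝓝 θ₁] fun θ ↦ σ (c (circlePoint θ)) := by
    refine eventuallyEq_of_lifts hctc.continuousAt ?_
      (fun θ ↦ by show P (ct θ) = P (σ (c (circlePoint θ))); rw [hσP', hct]) ?_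
    · have h1 : ContinuousAt (fun θ ↦ c (circlePoint θ)) θ₁ :=
        (hcc.comp continuous_circlePoint).continuousAt
      exact ContinuousAt.comp_of_eq hσc h1 (by rw [hθ₁, hcs₀])
    · rw [hθ₁, hcs₀, hσq]
  -- `γ̃ = τ₋ₘ₁ ∘ σ ∘ γ` near `0`
  have hlift2 : γt =ᶠ[𝓝 0] fun r ↦ τ (-m₁) (σ (γ r)) := by
    refine eventuallyEq_of_lifts hγs.continuous.continuousAt ?_ (fun r ↦ ?_) ?_
    · have h1 : ContinuousAt (fun r ↦ σ (γ r)) 0 :=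
        ContinuousAt.comp_of_eq hσc hγc.continuousAt (by rw [hγP0])
      exact (hτc _).continuousAt.comp h1
    · show P (γt r) = P (τ (-m₁) (σ (γ r)))
      rw [hPτ, hσP']
      rfl
    · show γt 0 = τ (-m₁) (σ (γ 0))
      rw [hγP0, hσq, hm₁, hττ, neg_add_cancel, hτ0, hγ0]
  -- the side function along the normal arc has a simple zero at `0`
  set k : ℝ → ℝ := fun r ↦ σp * G (γt r) with hkdef
  have hk0 : k 0 = 0 := by
    simp only [hkdef, hγ0]
    rw [(hG0 _).2 ⟨x₀, rfl⟩, mul_zero]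
  obtain ⟨k', hkd, hk'0⟩ : ∃ k' : ℝ, HasDerivAt k k' 0 ∧ k' ≠ 0 := by
    have hGγ : ContMDiff 𝓘(ℝ, ℝ) 𝓘(ℝ, ℝ) ∞ (G ∘ γt) := hGs.comp hγs
    have hGγd : ContDiff ℝ ∞ (G ∘ γt) := contMDiff_iff_contDiff.1 hGγ
    have hd1 : HasDerivAt (G ∘ γt) (deriv (G ∘ γt) 0) 0 :=
      ((hGγd.differentiable (by simp)) 0).hasDerivAt
    refine ⟨σp * deriv (G ∘ γt) 0, hd1.const_mul σp, mul_ne_zero hσp ?_⟩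
    -- `deriv (G ∘ γ̃) 0 = dG (dγ̃ 1) ≠ 0`
    have hchain : mfderiv 𝓘(ℝ, ℝ) 𝓘(ℝ, ℝ) (G ∘ γt) 0 =
        (mfderiv (𝓘(ℝ, ℝ).prod (𝓡 n)) 𝓘(ℝ, ℝ) G (γt 0)).comp
          (mfderiv 𝓘(ℝ, ℝ) (𝓘(ℝ, ℝ).prod (𝓡 n)) γt 0) :=
      mfderiv_comp 0 (hGs.mdifferentiableAt (by simp)) ((hγs 0).mdifferentiableAt (by simp))
    have hder : deriv (G ∘ γt) 0 = mfderiv 𝓘(ℝ, ℝ) 𝓘(ℝ, ℝ) (G ∘ γt) 0 (1 : ℝ) := by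
      rw [mfderiv_eq_fderiv]
      rfl
    rw [hder, hchain]
    change (mfderiv (𝓘(ℝ, ℝ).prod (𝓡 n)) 𝓘(ℝ, ℝ) G (γt 0))
      (mfderiv 𝓘(ℝ, ℝ) (𝓘(ℝ, ℝ).prod (𝓡 n)) γt 0 (1 : ℝ)) ≠ 0
    have hbase : ∀ w : ℝ × EuclideanSpace ℝ (Fin n),
        (mfderiv (𝓘(ℝ, ℝ).prod (𝓡 n)) 𝓘(ℝ, ℝ) G (γt 0)) w =
          (mfderiv (𝓘(ℝ, ℝ).prod (𝓡 n)) 𝓘(ℝ, ℝ) G (el x₀)) w := by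
      intro w
      rw [hγ0]
    rw [hbase]
    intro h0
    exact hγtr ((hGker x₀ _).1 h0)
  -- `k = F ∘ γ` near `0` and `hf m₁ = F ∘ c ∘ circlePoint` near `θ₁`, for `F = σp G ∘ τ₋ₘ₁ ∘ σ`
  set F : Circle × Metric.sphere (0 : EuclideanSpace ℝ (Fin (n + 1))) 1 → ℝ :=
    fun y ↦ σp * G (τ (-m₁) (σ y)) with hF
  have hkF : ∀ᶠ r in 𝓝 (0 : ℝ), k r = F (γ r) := by
    filter_upwards [hlift2] with r hr
    simp only [hkdef, hF, hr]
  have hhF : ∀ᶠ θ in 𝓝 θ₁, hf m₁ θ = F (c (circlePoint θ)) := by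
    filter_upwards [hlift1] with θ hθ
    simp only [hhf, hF, hθ]
  -- the sign change: `hf m₁` takes both signs near `θ₁`
  have hSC : ∀ ε > 0, ∃ θp θm : ℝ, |θp - θ₁| < ε ∧ |θm - θ₁| < ε ∧ 0 < hf m₁ θp ∧ hf m₁ θm < 0 := by
    intro ε hε
    obtain ⟨ε₁, hε₁, hball₁⟩ := Metric.eventually_nhds_iff.1 hhF
    set ε' := min ε ε₁ with hε'
    have hε'0 : 0 < ε' := lt_min hε hε₁
    -- the arc of the circle of angles within `ε'` of `θ₁` is open
    set Θ : Set (Metric.sphere (0 : EuclideanSpace ℝ (Fin 2)) 1) :=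
      circlePoint '' Ioo (θ₁ - ε') (θ₁ + ε') with hΘ
    have hΘo : IsOpen Θ := isOpenMap_circlePoint _ isOpen_Ioo
    obtain ⟨V', hV'o, hV'⟩ := hc.isEmbedding.isInducing.isOpen_iff.1 hΘo
    have hs₀Θ : s₀ ∈ Θ := ⟨θ₁, ⟨by linarith, by linarith⟩, hθ₁⟩
    have hγV' : ∀ᶠ r in 𝓝 (0 : ℝ), γ r ∈ V' := by
      refine hγc.continuousAt.preimage_mem_nhds (hV'o.mem_nhds ?_)
      rw [hγP0, ← hcs₀]
      have : s₀ ∈ c ⁻¹' V' := by rw [hV']; exact hs₀Θ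
      exact this
    have hγU : ∀ᶠ r in 𝓝 (0 : ℝ), γ r ∈ U := by
      refine hγc.continuousAt.preimage_mem_nhds ?_
      rw [hγP0, ← hcs₀, hs₀]
      exact hU
    have hγ1 : ∀ᶠ r in 𝓝 (0 : ℝ), r ∈ Icc (-1 : ℝ) 1 := Icc_mem_nhds (by norm_num) (by norm_num)
    obtain ⟨δ, hδ, hballδ⟩ := Metric.eventually_nhds_iff.1 (hkF.and (hγV'.and (hγU.and hγ1)))
    obtain ⟨r₁, r₂, hr₁, hr₂, hkr₁, hkr₂⟩ := exists_pos_neg_of_hasDerivAt hkd hk0 hk'0 hδ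
    -- transfer a small parameter `r` of the arc to an angle near `θ₁`
    have htransfer : ∀ r : ℝ, |r| < δ → ∃ θ : ℝ, |θ - θ₁| < ε ∧ hf m₁ θ = k r := by
      intro r hr
      obtain ⟨hkr, hrV', hrU, hr1⟩ := hballδ (by rwa [Real.dist_0_eq_abs])
      have hrc : γ r ∈ range c := by
        have : γ r ∈ γ '' Icc (-1) 1 ∩ U := ⟨⟨r, hr1, rfl⟩, hrU⟩
        rw [← hUeq] at this
        exact this.1
      obtain ⟨sr, hsr⟩ := hrc
      have hsrΘ : sr ∈ Θ := by
        rw [← hV']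
        show c sr ∈ V'
        rw [hsr]
        exact hrV'
      obtain ⟨θ, hθ, hθsr⟩ := hsrΘ
      refine ⟨θ, ?_, ?_⟩
      · have : |θ - θ₁| < ε' := by rw [abs_lt]; constructor <;> linarith [hθ.1, hθ.2]
        exact this.trans_le (min_le_left _ _)
      · have hθε₁ : dist θ θ₁ < ε₁ := by
          rw [Real.dist_eq]
          have : |θ - θ₁| < ε' := by rw [abs_lt]; constructor <;> linarith [hθ.1, hθ.2]
          exact this.trans_le (min_le_right _ _)
        rw [hball₁ hθε₁, hθsr, hsr, ← hkr]
    obtain ⟨θp, hθp, hθpk⟩ := htransfer r₁ hr₁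
    obtain ⟨θm, hθm, hθmk⟩ := htransfer r₂ hr₂
    exact ⟨θp, θm, hθp, hθm, by rw [hθpk]; exact hkr₁, by rw [hθmk]; exact hkr₂⟩
  have hjump : ¬ (s m₁ ↔ s (m₁ - d)) := by
    simp only [hsdef]
    rw [← hf_turn]
    obtain ⟨θp, θm, hθp, hθm, hpos, hneg⟩ := hSC π Real.pi_pos
    rw [abs_lt] at hθp hθm
    refine not_neg_iff_neg_of_sign_change hle (hfc m₁).continuousOn
      (fun θ hθ h0 ↦ (hf_zero θ hθ m₁ h0).1) (by linarith [Real.pi_pos]) (by linarith [Real.pi_pos])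
      ⟨by linarith, by linarith⟩ ⟨by linarith, by linarith⟩ hpos hneg
  -- ### the tails, and the conclusion
  refine ⟨c, hc, ⟨s₀, hcs₀, fun s' hs' ↦ hcO s' hs'⟩,
    ⟨γ, hγPs, hγPinj, hγPimm, hγP0, hγPtr, U, by rw [← hγP0]; exact hU, hUeq⟩,
    ct, d, hctc, hct, hdeck, ?_⟩
  rcases lt_trichotomy (σp * σm) 0 with hopp | h0 | hsame
  · -- opposite signs at the two ends: `s` false far left, true far right
    refine OneJump.eq_one_or_eq_neg_one_of_tails' hrel hjump
      (M := max (Int.ceil ((Tp - (ct θ₀).1) / (2 * π))) (Int.ceil (((ct θ₀).1 - Tm) / (2 * π))))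
      (fun m hm ↦ ?_) (fun m hm ↦ ?_)
    · -- far left: the translated point is beyond `Tp`, where `σp G > 0`
      simp only [hsdef, hhf, not_lt]
      have h1 : Tp ≤ (τ (-m) (ct θ₀)).1 :=
        le_add_neg_mul_two_pi (hm.trans (neg_le_neg (le_max_left _ _)))
      exact (hTp _ h1).le
    · -- far right: the translated point is below `Tm`, where `σm G > 0`, hence `σp G < 0`
      simp only [hsdef, hhf]
      have h1 : (τ (-m) (ct θ₀)).1 ≤ Tm := add_neg_mul_two_pi_le ((le_max_right _ _).trans hm)
      have h4 := hTm _ h1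
      -- `σm G > 0` and `σp σm < 0` give `σp G < 0`
      by_contra h5
      push Not at h5
      have hG : G (τ (-m) (ct θ₀)) ≠ 0 := by
        intro h0
        rw [h0, mul_zero] at h4
        exact lt_irrefl _ h4
      have hG2 : 0 < (G (τ (-m) (ct θ₀))) ^ 2 :=
        lt_of_le_of_ne (sq_nonneg _) (Ne.symm (pow_ne_zero 2 hG))
      nlinarith [mul_nonneg h5 h4.le, mul_neg_of_neg_of_pos hopp hG2]
  · exact (mul_ne_zero hσp hσm h0).elim
  · -- equal signs: `{σp G ≤ 0}` is bounded, contradicting the one-jump structure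
    exfalso
    obtain ⟨T, hT⟩ := hbdd hsame
    refine OneJump.false_of_bounded hrel hjump (M := Int.ceil ((T + |(ct θ₀).1|) / (2 * π)) + 1)
      (fun m hm hsm ↦ ?_)
    have h1 : |(τ (-m) (ct θ₀)).1| ≤ T := hT _ (show σp * G (τ (-m) (ct θ₀)) < 0 from hsm).le
    exact not_lt.2 h1 (lt_abs_add_neg_mul_two_pi hm)

end BudneyGabai2019_thm_3_13

end Literature.Topology.FourManifolds

end
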